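import Summits.QuantumFields.YangMills.Theorems.BalabanLadderNTMarkovMirror
import HarnessLib

/-!
# Crux `NT` (stmt-QuantumFields-19353) / `UVSeamRec.stub_floorsEngine` (stmt-QuantumFields-20043):
# X3 — the Markov factorisation for THREE separated cubes (third cumulant)

Tenth file of the Markov–mirror series (fleet lead prover of crux `UVSeamRec`, unit `ym-spine-20043-p1`, g6): the
card's second exact identity X3 (`Cruxes/NT/Ideas/markov-mirror-dirichlet-response.md`, Sketch §E
`tK3_lift_eq_tK3_kerE`, «claimed PROVABLE NOW, M»).  For three cubes `Q₁, Q₂, Q₃` of `ℤ⁴` inside one torus window,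
pairwise separated by at least one lattice layer in some coordinate direction, and bounded continuous cylinder
observables `F, H, K` carried by them:

* `integral_lift_mul_mul_eq` — `E_T[F̃ H̃ K̃] = E_T[m_F m_H m_K]`, `m_X = kerE_{Q_X}(X)∘lift` (three one-sided DLR
  steps `integral_mul_lift_eq_integral_mul_kerE`, the spectator being each time the product of the other two
  factors — raw observables not yet pulled, boundary responses already pulled);
* `torusCum3_lift_eq_torusCum3_kerE` — **X3**: the torus third cumulant of `F, H, K` equals that of `m_F, m_H, m_K`
  (with X2 for the three pairs and the one-cube DLR step for the singles): clause (ii)'s `Q3(f,g,h) = κ₃^T(m_f,m_g,m_h)`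
  exactly for separated smearings.  The card records honestly that the tree-level leader of the right-hand side
  vanishes in the scaling regime (chirality selection rule), so clause (ii) needs RBL to second order — this file
  proves the identity, not a floor.
-/

set_option autoImplicit false

noncomputable section

open MeasureTheory Filter Topology
open Literature.MathematicalPhysics.QuantumFieldTheory Literature.MathematicalPhysics.QuantumLattice
open Literature.Probability.LatticeModels
open Summit.QuantumFields.YangMills.Cruxes.OSLegsFromFemtoAndGap.DlrCollarTransfer
open Summit.QuantumFields.YangMills.Cruxes.OSLegsFromFemtoAndGap.DlrCollarTransfer.StubLower (isCylinder_mul)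
open Summit.QuantumFields.YangMills.Cruxes.NT.Reference (continuous_kerE abs_mul_le_of_abs_le)
open Summit.QuantumFields.YangMills.Cruxes.NT.BoundaryLaw (abs_kerE_le)
open Summit.QuantumFields.YangMills.Cruxes.OSLegsAtWeakCouplingC.InheritedAmplitudeGates.StubInherit
  (integral_lift_eq_integral_kerE_cube)

namespace Summit.QuantumFields.YangMills.Cruxes.NT.MarkovMirror

section Three

variable (G : Type) [Group G] [TopologicalSpace G] [IsTopologicalGroup G] [CompactSpace G]
  [MeasurableSpace G] [BorelSpace G] (r : LatticeRep G)

/-- Window bookkeeping: a union of two link sets based in `[cᵢ − 1, cᵢ + b]` (i = 1, 2) sits in the torus window when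
both cubes do. [folklore] -/
theorem union_window {c₁ c₂ lo : Fin 4 → ℤ} {b T : ℕ}
    (h₁ : ∀ j, lo j + 2 ≤ c₁ j ∧ c₁ j + (b : ℤ) + 2 ≤ lo j + T)
    (h₂ : ∀ j, lo j + 2 ≤ c₂ j ∧ c₂ j + (b : ℤ) + 2 ≤ lo j + T)
    {S₁ S₂ : Finset (Literature.MathematicalPhysics.QuantumLattice.ZdEdge 4)}
    (hS₁ : ∀ e ∈ S₁, ∀ j, c₁ j - 1 ≤ e.1 j ∧ e.1 j ≤ c₁ j + b)
    (hS₂ : ∀ e ∈ S₂, ∀ j, c₂ j - 1 ≤ e.1 j ∧ e.1 j ≤ c₂ j + b) :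
    ∀ e ∈ S₁ ∪ S₂, ∀ j, lo j + 1 ≤ e.1 j ∧ e.1 j + 2 ≤ lo j + T := by
  intro e he j
  rcases Finset.mem_union.1 he with h | h
  · have := hS₁ e h j; have := h₁ j; constructor <;> linarith
  · have := hS₂ e h j; have := h₂ j; constructor <;> linarith

/-- **Three-cube pull-through**: `E_T[F̃ H̃ K̃] = E_T[m_F m_H m_K]` for bounded continuous cylinder observables carried
by three pairwise separated cubes of one torus window. [folklore] -/
theorem integral_lift_mul_mul_eq (β : ℝ) (c₁ c₂ c₃ : Fin 4 → ℤ) (b T : ℕ) [NeZero T] (lo : Fin 4 → ℤ)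
    (h₁ : ∀ j, lo j + 2 ≤ c₁ j ∧ c₁ j + (b : ℤ) + 2 ≤ lo j + T)
    (h₂ : ∀ j, lo j + 2 ≤ c₂ j ∧ c₂ j + (b : ℤ) + 2 ≤ lo j + T)
    (h₃ : ∀ j, lo j + 2 ≤ c₃ j ∧ c₃ j + (b : ℤ) + 2 ≤ lo j + T)
    (h₁₂ : ∃ j : Fin 4, c₁ j + (b : ℤ) + 1 ≤ c₂ j ∨ c₂ j + (b : ℤ) + 1 ≤ c₁ j)
    (h₁₃ : ∃ j : Fin 4, c₁ j + (b : ℤ) + 1 ≤ c₃ j ∨ c₃ j + (b : ℤ) + 1 ≤ c₁ j)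
    (h₂₃ : ∃ j : Fin 4, c₂ j + (b : ℤ) + 1 ≤ c₃ j ∨ c₃ j + (b : ℤ) + 1 ≤ c₂ j)
    {F H K : LGConfig 4 G → ℝ} (hFc : Continuous F) (hHc : Continuous H) (hKc : Continuous K)
    {MF MH MK : ℝ} (hMF : ∀ U, |F U| ≤ MF) (hMH : ∀ U, |H U| ≤ MH) (hMK : ∀ U, |K U| ≤ MK)
    {SF SH SK : Finset (Literature.MathematicalPhysics.QuantumLattice.ZdEdge 4)}
    (hFS : IsCylinder F SF) (hHS : IsCylinder H SH) (hKS : IsCylinder K SK)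
    (hSF : ∀ e ∈ SF, ∀ j, c₁ j ≤ e.1 j ∧ e.1 j ≤ c₁ j + b)
    (hSH : ∀ e ∈ SH, ∀ j, c₂ j ≤ e.1 j ∧ e.1 j ≤ c₂ j + b)
    (hSK : ∀ e ∈ SK, ∀ j, c₃ j ≤ e.1 j ∧ e.1 j ≤ c₃ j + b) :
    ∫ U, F (torusLift T U) * H (torusLift T U) * K (torusLift T U) ∂(wilsonMeasure (d := 4) (L := T) r.ρ β) =
      ∫ U, kerE G r β c₁ b (torusLift T U) F * kerE G r β c₂ b (torusLift T U) H *
        kerE G r β c₃ b (torusLift T U) K ∂(wilsonMeasure (d := 4) (L := T) r.ρ β) := by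
  haveI := r.secondCountableTopology
  obtain ⟨j₁₂, hj₁₂⟩ := h₁₂
  obtain ⟨j₁₃, hj₁₃⟩ := h₁₃
  obtain ⟨j₂₃, hj₂₃⟩ := h₂₃
  -- widened windows of the raw supports
  have hSF' : ∀ e ∈ SF, ∀ j, c₁ j - 1 ≤ e.1 j ∧ e.1 j ≤ c₁ j + b :=
    fun e he j => ⟨by linarith [(hSF e he j).1], (hSF e he j).2⟩
  have hSH' : ∀ e ∈ SH, ∀ j, c₂ j - 1 ≤ e.1 j ∧ e.1 j ≤ c₂ j + b :=
    fun e he j => ⟨by linarith [(hSH e he j).1], (hSH e he j).2⟩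
  have hSK' : ∀ e ∈ SK, ∀ j, c₃ j - 1 ≤ e.1 j ∧ e.1 j ≤ c₃ j + b :=
    fun e he j => ⟨by linarith [(hSK e he j).1], (hSK e he j).2⟩
  -- the boundary responses as spectators
  have hkFc : Continuous fun η => kerE G r β c₁ b η F := continuous_kerE G r β c₁ b hFc hMF
  have hkFb : ∀ η, |kerE G r β c₁ b η F| ≤ MF := fun η => abs_kerE_le G r β c₁ b η hMF
  have hkFS := isCylinder_kerE G r β c₁ b hFc.measurable hFS
  have hkFw : ∀ e ∈ SF ∪ (plaquettesTouching (cubeEdges c₁ b)).biUnion plaquetteEdges, ∀ j,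
      c₁ j - 1 ≤ e.1 j ∧ e.1 j ≤ c₁ j + b := fun e he => kerE_supp_window hSF he
  have hkHc : Continuous fun η => kerE G r β c₂ b η H := continuous_kerE G r β c₂ b hHc hMH
  have hkHb : ∀ η, |kerE G r β c₂ b η H| ≤ MH := fun η => abs_kerE_le G r β c₂ b η hMH
  have hkHS := isCylinder_kerE G r β c₂ b hHc.measurable hHS
  have hkHw : ∀ e ∈ SH ∪ (plaquettesTouching (cubeEdges c₂ b)).biUnion plaquetteEdges, ∀ j,
      c₂ j - 1 ≤ e.1 j ∧ e.1 j ≤ c₂ j + b := fun e he => kerE_supp_window hSH he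
  have hc₁ : ∀ j, lo j + 1 ≤ c₁ j ∧ c₁ j + (b : ℤ) + 2 ≤ lo j + T := fun j => ⟨by linarith [(h₁ j).1], (h₁ j).2⟩
  have hc₂ : ∀ j, lo j + 1 ≤ c₂ j ∧ c₂ j + (b : ℤ) + 2 ≤ lo j + T := fun j => ⟨by linarith [(h₂ j).1], (h₂ j).2⟩
  have hc₃ : ∀ j, lo j + 1 ≤ c₃ j ∧ c₃ j + (b : ℤ) + 2 ≤ lo j + T := fun j => ⟨by linarith [(h₃ j).1], (h₃ j).2⟩
  -- step 1: pull `F` through `Q₁`, spectator `H · K`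
  have step1 := integral_mul_lift_eq_integral_mul_kerE G r β c₁ b T lo hc₁ hFc (hHc.mul hKc) hMF
    (abs_mul_le_of_abs_le G hMH hMK) hFS (isCylinder_mul hHS hKS) hSF
    (fun e he => by
      rcases Finset.mem_union.1 he with h | h
      · exact not_mem_cubeEdges_of_separated hj₁₂ (hSH' e h j₁₂)
      · exact not_mem_cubeEdges_of_separated hj₁₃ (hSK' e h j₁₃))
    (union_window h₂ h₃ hSH' hSK')
  -- step 2: pull `H` through `Q₂`, spectator `m_F · K`
  have step2 := integral_mul_lift_eq_integral_mul_kerE G r β c₂ b T lo hc₂ hHc (hkFc.mul hKc) hMH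
    (abs_mul_le_of_abs_le G hkFb hMK) hHS (isCylinder_mul hkFS hKS) hSH
    (fun e he => by
      rcases Finset.mem_union.1 he with h | h
      · exact not_mem_cubeEdges_of_separated hj₁₂.symm (hkFw e h j₁₂)
      · exact not_mem_cubeEdges_of_separated hj₂₃ (hSK' e h j₂₃))
    (union_window h₁ h₃ hkFw hSK')
  -- step 3: pull `K` through `Q₃`, spectator `m_F · m_H`
  have step3 := integral_mul_lift_eq_integral_mul_kerE G r β c₃ b T lo hc₃ hKc (hkFc.mul hkHc) hMK
    (abs_mul_le_of_abs_le G hkFb hkHb) hKS (isCylinder_mul hkFS hkHS) hSK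
    (fun e he => by
      rcases Finset.mem_union.1 he with h | h
      · exact not_mem_cubeEdges_of_separated hj₁₃.symm (hkFw e h j₁₃)
      · exact not_mem_cubeEdges_of_separated hj₂₃.symm (hkHw e h j₂₃))
    (union_window h₁ h₂ hkFw hkHw)
  calc ∫ U, F (torusLift T U) * H (torusLift T U) * K (torusLift T U) ∂(wilsonMeasure (d := 4) (L := T) r.ρ β)
      = ∫ U, (H (torusLift T U) * K (torusLift T U)) * F (torusLift T U) ∂(wilsonMeasure (d := 4) (L := T) r.ρ β) :=
        integral_congr_ae (ae_of_all _ fun U => by ring)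
    _ = ∫ U, (H (torusLift T U) * K (torusLift T U)) * kerE G r β c₁ b (torusLift T U) F
          ∂(wilsonMeasure (d := 4) (L := T) r.ρ β) := step1
    _ = ∫ U, (kerE G r β c₁ b (torusLift T U) F * K (torusLift T U)) * H (torusLift T U)
          ∂(wilsonMeasure (d := 4) (L := T) r.ρ β) := integral_congr_ae (ae_of_all _ fun U => by ring)
    _ = ∫ U, (kerE G r β c₁ b (torusLift T U) F * K (torusLift T U)) * kerE G r β c₂ b (torusLift T U) H
          ∂(wilsonMeasure (d := 4) (L := T) r.ρ β) := step2
    _ = ∫ U, (kerE G r β c₁ b (torusLift T U) F * kerE G r β c₂ b (torusLift T U) H) * K (torusLift T U)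
          ∂(wilsonMeasure (d := 4) (L := T) r.ρ β) := integral_congr_ae (ae_of_all _ fun U => by ring)
    _ = _ := step3

/-- **X3 — the torus third cumulant of three separated cube observables is the third cumulant of their boundary
responses** (odd torus `2L+1`, `torusE` vocabulary; cubes at `−L + 2 ≤ cᵢ`, `cᵢ + b + 2 ≤ L + 1`, pairwise separated by
one lattice layer). [folklore] -/
theorem torusCum3_lift_eq_torusCum3_kerE (β : ℝ) (c₁ c₂ c₃ : Fin 4 → ℤ) (b L : ℕ)
    (h₁ : ∀ j, -(L : ℤ) + 2 ≤ c₁ j ∧ c₁ j + (b : ℤ) + 2 ≤ (L : ℤ) + 1)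
    (h₂ : ∀ j, -(L : ℤ) + 2 ≤ c₂ j ∧ c₂ j + (b : ℤ) + 2 ≤ (L : ℤ) + 1)
    (h₃ : ∀ j, -(L : ℤ) + 2 ≤ c₃ j ∧ c₃ j + (b : ℤ) + 2 ≤ (L : ℤ) + 1)
    (h₁₂ : ∃ j : Fin 4, c₁ j + (b : ℤ) + 1 ≤ c₂ j ∨ c₂ j + (b : ℤ) + 1 ≤ c₁ j)
    (h₁₃ : ∃ j : Fin 4, c₁ j + (b : ℤ) + 1 ≤ c₃ j ∨ c₃ j + (b : ℤ) + 1 ≤ c₁ j)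
    (h₂₃ : ∃ j : Fin 4, c₂ j + (b : ℤ) + 1 ≤ c₃ j ∨ c₃ j + (b : ℤ) + 1 ≤ c₂ j)
    {F H K : LGConfig 4 G → ℝ} (hFc : Continuous F) (hHc : Continuous H) (hKc : Continuous K)
    {MF MH MK : ℝ} (hMF : ∀ U, |F U| ≤ MF) (hMH : ∀ U, |H U| ≤ MH) (hMK : ∀ U, |K U| ≤ MK)
    {SF SH SK : Finset (Literature.MathematicalPhysics.QuantumLattice.ZdEdge 4)}
    (hFS : IsCylinder F SF) (hHS : IsCylinder H SH) (hKS : IsCylinder K SK)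
    (hSF : ∀ e ∈ SF, ∀ j, c₁ j ≤ e.1 j ∧ e.1 j ≤ c₁ j + b)
    (hSH : ∀ e ∈ SH, ∀ j, c₂ j ≤ e.1 j ∧ e.1 j ≤ c₂ j + b)
    (hSK : ∀ e ∈ SK, ∀ j, c₃ j ≤ e.1 j ∧ e.1 j ≤ c₃ j + b) :
    torusE G r β L (fun U => F U * H U * K U)
      - torusE G r β L F * torusE G r β L (fun U => H U * K U)
      - torusE G r β L H * torusE G r β L (fun U => F U * K U)
      - torusE G r β L K * torusE G r β L (fun U => F U * H U)
      + 2 * (torusE G r β L F * torusE G r β L H * torusE G r β L K) =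
    torusE G r β L (fun η => kerE G r β c₁ b η F * kerE G r β c₂ b η H * kerE G r β c₃ b η K)
      - torusE G r β L (fun η => kerE G r β c₁ b η F) *
          torusE G r β L (fun η => kerE G r β c₂ b η H * kerE G r β c₃ b η K)
      - torusE G r β L (fun η => kerE G r β c₂ b η H) *
          torusE G r β L (fun η => kerE G r β c₁ b η F * kerE G r β c₃ b η K)
      - torusE G r β L (fun η => kerE G r β c₃ b η K) *
          torusE G r β L (fun η => kerE G r β c₁ b η F * kerE G r β c₂ b η H)
      + 2 * (torusE G r β L (fun η => kerE G r β c₁ b η F) * torusE G r β L (fun η => kerE G r β c₂ b η H) *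
          torusE G r β L (fun η => kerE G r β c₃ b η K)) := by
  have hT : b + 3 ≤ 2 * L + 1 := by have := h₁ 0; omega
  have hw : ∀ (c : Fin 4 → ℤ), (∀ j, -(L : ℤ) + 2 ≤ c j ∧ c j + (b : ℤ) + 2 ≤ (L : ℤ) + 1) →
      ∀ j, (fun _ : Fin 4 => -(L : ℤ)) j + 2 ≤ c j ∧ c j + (b : ℤ) + 2 ≤ (fun _ : Fin 4 => -(L : ℤ)) j + (2 * L + 1 : ℕ) :=
    fun c hc j => ⟨(hc j).1, by push_cast; linarith [(hc j).2]⟩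
  unfold torusE
  rw [integral_lift_mul_mul_eq G r β c₁ c₂ c₃ b (2 * L + 1) (fun _ => -(L : ℤ)) (hw c₁ h₁) (hw c₂ h₂) (hw c₃ h₃)
      h₁₂ h₁₃ h₂₃ hFc hHc hKc hMF hMH hMK hFS hHS hKS hSF hSH hSK,
    integral_lift_mul_lift_eq_integral_kerE_mul_kerE G r β c₂ c₃ b (2 * L + 1) (fun _ => -(L : ℤ)) (hw c₂ h₂)
      (hw c₃ h₃) h₂₃ hHc hKc hMH hMK hHS hKS hSH hSK,
    integral_lift_mul_lift_eq_integral_kerE_mul_kerE G r β c₁ c₃ b (2 * L + 1) (fun _ => -(L : ℤ)) (hw c₁ h₁)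
      (hw c₃ h₃) h₁₃ hFc hKc hMF hMK hFS hKS hSF hSK,
    integral_lift_mul_lift_eq_integral_kerE_mul_kerE G r β c₁ c₂ b (2 * L + 1) (fun _ => -(L : ℤ)) (hw c₁ h₁)
      (hw c₂ h₂) h₁₂ hFc hHc hMF hMH hFS hHS hSF hSH,
    integral_lift_eq_integral_kerE_cube G r β c₁ b (2 * L + 1) hT hFc hMF hFS hSF,
    integral_lift_eq_integral_kerE_cube G r β c₂ b (2 * L + 1) hT hHc hMH hHS hSH,
    integral_lift_eq_integral_kerE_cube G r β c₃ b (2 * L + 1) hT hKc hMK hKS hSK]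

end Three

end Summit.QuantumFields.YangMills.Cruxes.NT.MarkovMirror

end
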